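import Summits.QuantumFields.YangMills.Theorems.AlphaInputsT3ACAnnulusSplit
import Summits.QuantumFields.YangMills.Theorems.AlphaInputsT3ACAnnulusSmallFactor
import HarnessLib

/-!
# `AlphaInputsT3ACAnnulusGapOfLetters` — THE ONE NAME THE (R7) DOCKET CITES FOR (★3): the `b`-free pin-gap bound `log ∫χ·G ≤ log ∫χ·𝟙[loPrintAC k]·G + log(1 + |Λ_k|·e^{−E}·Λund)`
# = door 6 §4 (✓`PkgCoreRows.log_gap_le_of_annulus`, px20 g14) ∘ the a-door (✓`AnnulusSmallFactor.a_door`, `sum_a_door_div`, w8 g17), displaying exactly the letters of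
# RECORD 17ee's bill {`hsf` (tree-fed: ✓`smallFactor_deterministic_loc_scaled`), `hG` (local-action factorisation, pin-definitional), `hund` (B0: local undamping ratio),
# `0 < b ≤ bulk`} (cell ym3-torus, ★★OWNER g38 WORD №160 «GO compose»; seat ym-ust-19936-w8 g17; helper `--supports stmt-QuantumFields-19936`)

WHY.  The χ-clash of the registered (O‴χₛ) rows (✓`PinnedStepChiClash`) forces the post-freeze planner to pay, under (R7a), ONE analytic fact (★): the fluctuation mass of the annulus
`W_k ⊆ {ε₁∕max(B₃,1) ≤ |U(∂p′) − 1| < ε₁}` is large-field-small.  Door 6 split it as `log ∫χG ≤ log ∫χ·𝟙[lo]G + log(1 + Σ_p a_p ∕ b)`; the a-door supplies `a_p = e^{−E}·Λund·b`;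
composed, THE BULK VALUE `b` CANCELS and the gap is `log(1 + |plaquettes|·e^{−E}·Λund)` — with `E := (c²∕4)p(g_k)² − rem_k` and `Λund ≤ (C_L∕g_k)^{ν_L}` superpolynomially small
(`r_k`; ✓`B10.smallFactor_le_pow`).  This file is that composition, record-free in `(μ, Ψ, χ, G)` and in the rows record `q` only through door 6's (★2) inclusion.
HONEST SCOPE.  [folklore] composition of landed helpers; `hsf`, `hfac`, `hund`, `hb`, `hb₁`, `ha₁` are HYPOTHESES; no (58) value, no `r_k` row text, no registry object; nothing of
[Balaban1985UV3] asserted; (★)'s letters, #22∕#23, (O‴χₛ), `HistoryTailL` (19936), EX NOT proved; def-free; count-neutral.  Rung R3 bookkeeping; not d = 4, not a mass gap, not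
Clay; the Yang–Mills mass gap is NOT proved.
References: T. Bałaban, Commun. Math. Phys. 102 (1985) 255–275 [Balaban1985UV3] ((11) p.258, (47) p.267, (67)–(71) p.273); 102 (1985) 277–309 [Balaban1985Variational] (Thm 1 (8) p.279).
-/

set_option autoImplicit false

noncomputable section

namespace Summit.QuantumFields.YangMills.Theorems

open MeasureTheory Literature.MathematicalPhysics.QuantumFieldTheory.Balaban1983to89
open Literature.MathematicalPhysics.QuantumFieldTheory.Balaban1983to89.T3ContinuumYM3Torus
open Literature.MathematicalPhysics.QuantumFieldTheory.Balaban1983to89.T3UnitScaleTilt (θBal)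
open Literature.MathematicalPhysics.QuantumFieldTheory.Balaban1985CMP102 Literature.MathematicalPhysics.QuantumFieldTheory.Balaban1985CMP102.Setting
open Summit.QuantumFields.Balaban3D.Carriers
open Summit.QuantumFields.Balaban3D.Proofs.Primitives
open Summit.QuantumFields.Balaban3D.Proofs.TowerAC Summit.QuantumFields.Balaban3D.Proofs.StandardAC Summit.QuantumFields.Balaban3D.Proofs.InputsAC

variable {F : T3Family} {𝔠 : AlphaConsts F.L (suGroupModel 2).N} {γ : ℝ} {hγ : 0 < γ} {hγ1 : γ ≤ (min 𝔠.gamma0 1) ^ 2} {K : ℕ}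

namespace AlphaInputsT3AC.PkgCoreRows

variable (q : AlphaInputsT3AC.PkgCoreRows F 𝔠 γ hγ hγ1 K)

/-- ★★★ **THE `b`-FREE PIN GAP FROM THE LETTERS OF RECORD 17ee.**  For the rows record `q` (only its (★2) inclusion is used, under the [7] data-smallness letter `ha₁`), a
level `k ≤ K`, ANY measure `μ`, measurable field map `Ψ` into the level-`k` fields, weight `χ ≥ 0`, integrand `G ≥ 0` with `χ·G` integrable, and PER LEVEL-`k` PLAQUETTE `p`:
the local-action factorisation `G = e^{−ℓ_p}·Gt_p` (`hfac`, `Gt_p ≥ 0`, `χ·Gt_p` integrable), the SMALL-FACTOR letter `hsf` («`E ≤ ℓ_p` on the `p`-annulus» — (71) at threshold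
`θBal∕max(B₃,1)`, ✓`smallFactor_deterministic_loc_scaled`) and the LOCAL-UNDAMPING letter `hund` («`∫χ·Gt_p ≤ Λund·b`», B0) — together with the bulk `0 < b ≤ ∫χ·𝟙[loPrintAC k](Ψ·)·G`:
`log ∫χ·G ≤ log ∫χ·𝟙[loPrintAC k](Ψ·)·G + log (1 + |Plaq_k|·(e^{−E}·Λund))`.  The VALUE of `b` does not appear in the conclusion. [cite: Balaban1985UV3, (67)-(71) p.273] -/
theorem log_gap_le_of_letters (ha₁ : ∀ i, θBal F.L γ 𝔠.b₀ 𝔠.p₀ i ≤ q.a₁) (k : ℕ) (hk : k ≤ K)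
    {β : Type*} [MeasurableSpace β] (μ : Measure β)
    (Ψ : β → GaugeField (F.P K) k (Matrix.specialUnitaryGroup (Fin 2) ℂ)) (hΨ : Measurable Ψ)
    {χ G : β → ℝ} (hχ : ∀ x, 0 ≤ χ x) (hG : ∀ x, 0 ≤ G x) (hint : Integrable (fun x => χ x * G x) μ)
    (Gt ℓ : Plaq (F.P K) k → β → ℝ) (hGt : ∀ p x, 0 ≤ Gt p x) (hfac : ∀ p x, G x = Real.exp (-(ℓ p x)) * Gt p x)
    (hintp : ∀ p, Integrable (fun x => χ x * Gt p x) μ)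
    {E : ℝ} (hsf : ∀ p x, Ψ x ∈ {U : GaugeField (F.P K) k (Matrix.specialUnitaryGroup (Fin 2) ℂ) |
        θBal F.L γ 𝔠.b₀ 𝔠.p₀ (K - k) / max 𝔠.B₃ 1 ≤ GaugeGroup.dist1 (GaugeField.plaqHol U p)} → E ≤ ℓ p x)
    {Λund b : ℝ} (hund : ∀ p, ∫ x, χ x * Gt p x ∂μ ≤ Λund * b)
    (hb : 0 < b) (hb₁ : b ≤ ∫ x, χ x * (PinnedStep.loPrintAC 𝔠.lane q.X k).indicator (fun _ => (1 : ℝ)) (Ψ x) * G x ∂μ) :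
    Real.log (∫ x, χ x * G x ∂μ) ≤
      Real.log (∫ x, χ x * (PinnedStep.loPrintAC 𝔠.lane q.X k).indicator (fun _ => (1 : ℝ)) (Ψ x) * G x ∂μ)
        + Real.log (1 + (Fintype.card (Plaq (F.P K) k) : ℝ) * (Real.exp (-E) * Λund)) := by
  have h := q.log_gap_le_of_annulus ha₁ k hk μ Ψ hΨ hχ hG hint (fun _ => Real.exp (-E) * Λund * b)
    (fun p => AnnulusSmallFactor.a_door μ Ψ _ hχ (hGt p) (hfac p) (hsf p) (hintp p) (hund p)) hb hb₁
  rwa [AnnulusSmallFactor.sum_a_door_div hb.ne'] at h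

end AlphaInputsT3AC.PkgCoreRows

end Summit.QuantumFields.YangMills.Theorems

end
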